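/-
Copyright (c) 2026 the pub-hodgecm-mathlib formalisation cell (harness21).  Prover seat hodgecm-mathlib-K2E1-p13 (g3), Track B ∕ K2-LIT, h413 = `stmt-HodgeConjecture-24833`,
line `K2_E1_TraceFormulaBeta`, route of record `HCCMUnconditional`; dealer K2E1-plan (g7) (254)∕(258): the (d)-realness road at M1 with ALL THREE sockets CLOSED — σ1 `hdec` by ★
K2E1-p12 `hdec_maximalLevel_cm_two`, σ2 (FE) by ★ `chi_scattering_fe_m1_cm_two` (this seat), σ3 (conj) inside ★ `chi_scattering_real_poles_m1_letterFree_cm_two` (this seat).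
-/
import Summits.HodgeConjecture.HodgeConjecture.Theorems.K2E1ChiScatteringRealPolesM1CMTwoLetterFree     -- ★ p860743 (this seat): `chi_scattering_real_poles_m1_letterFree_cm_two`
import Summits.HodgeConjecture.HodgeConjecture.Theorems.K2E1ChiScatteringFunctionalEquationM1CMTwo    -- ★ p860766 (this seat): σ2 `chi_scattering_fe_m1_cm_two`
import Summits.HodgeConjecture.HodgeConjecture.Theorems.K2E1ChiMaassSelbergDecayLetterM1CMTwo         -- ★ p860725 (K2E1-p12): σ1 `hdec_maximalLevel_cm_two`
import HarnessLib

/-!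
# K2·E1 — `K2E1ChiScatteringRealPolesM1CMTwoComplete`: `hreal` AND `hs` FOR THE SCATTERING SCALAR OF A SELF-DUAL UNITARY `χ` OF `U(1,1)_{L∕L⁺}` AT M1 — LETTER-FREE
# (the (d)-column of the (SD) M1 bill: every genuine pole of `s = qc default` in `½ < Re ≤ σ₀` is REAL, finitely many, `s` holomorphic on a neighbourhood of the closed strip off them)

Track B ∕ K2-LIT, crux h413 = `stmt-HodgeConjecture-24833`; cell `hodgecm-mathlib`, squad K2, ENGINE E1, campaign «5Res», (d)-block at M1 (consumer: K2E1-p14 (g2)'s (SD) M1 final assembly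
`K2E1ChiSectionPlancherelSelfDualM1CMTwo`, binders `hs ∕ S ∕ hS ∕ hUo ∕ hUs`).  THEOREMS ONLY (no `def`, no `instance`, no notation, no named-fact hypothesis, no `sorry`; default heartbeats);
lane `--kind proof --supports stmt-HodgeConjecture-24833 --as helper` (count-neutral).  Closes no socket.

THE MATHEMATICS ([MoeglinWaldspurger1995, IV.1.10–IV.1.11, IV.2.3, IV.3.12 (a)]; [BernsteinLapid2019, Thm 2.3, §4–§5]; [Langlands1976, §7]).  ★ `chi_scattering_real_poles_m1_letterFree_cm_two`
gives the scalar package of a self-dual unitary `χ` at M1 together with `hreal ∧ hs` under the socket `hdec` (constant-term decay above every level) and, inside, the scalar (FE).  Both are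
now ★: `hdec` is ★ K2E1-p12 `hdec_maximalLevel_cm_two` (M1 sections are constant along the archimedean line; ★ `…_of_archSmooth`), and (FE) `qc(z)·qc(1 − z) = 1` off `P ∪ (1 − P)` is ★
`chi_scattering_fe_m1_cm_two` (★ C3 FILE 2 on the `n = 0` ball package), applied to THE package's own clauses.  RESULT **`chi_scattering_real_poles_m1_complete_cm_two`**: for `χ` self-dual
unitary trivial on `ℝ_{>0}` and `φ ∈ V(χ, K_max, 1)` continuous bounded with `φ ∘ ι_∞ = φ(1)`, `φ(1) ≠ 0` real — ★ K2E4-p14's ∃-package VERBATIM (singleton basis `{φ}`, `q`, `Ec`, the scalar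
`qc`, ONE pole set `P`, (E1)–(E4), the Maass–Selberg families, the tube formula) **and** `∀ σ₀ > 1`, `hreal ∧ ∃ S U′, …` for `s := qc default` — NO LETTERS beyond the structural data.
HONEST LABEL: HC_CM is proved only modulo the 7 printed citations (2 remaining named inputs: hLiu418 = `stmt-HodgeConjecture-24832`, h413 = `stmt-HodgeConjecture-24833`) until rung 0
closes; this file asserts no named fact and closes no socket; count-neutral.

## References
* [MoeglinWaldspurger1995] C. Mœglin, J.-L. Waldspurger, *Spectral decomposition and Eisenstein series* (1995), IV.1.10–IV.1.11, IV.2.3, IV.3.12 (a).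
* [BernsteinLapid2019] J. Bernstein, E. Lapid, *On the meromorphic continuation of Eisenstein series*, J. AMS 37 (2024), Thm 2.3, §4–§5.
* [Langlands1976] R. P. Langlands, *On the Functional Equations Satisfied by Eisenstein Series*, LNM 544 (1976), §7.
-/

set_option autoImplicit false
set_option linter.dupNamespace false  -- the mandated namespace repeats the summit's segment (`HodgeConjecture.HodgeConjecture`)

noncomputable section

open MeasureTheory MeasureTheory.Measure Set NumberField IsDedekindDomain Filter Topology Metric
open scoped NNReal ENNReal ComplexConjugate InnerProductSpace
open Literature.MeasureTheory.Group Literature.NumberTheory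
open Literature.NumberTheory.Automorphic Literature.NumberTheory.Automorphic.UnitaryGroup AdelicGroupData
open Literature.NumberTheory.GaloisRepresentations
open Summit.HodgeConjecture.HodgeConjecture.Cruxes.H413.K2E1BorelEisensteinU
open Summit.HodgeConjecture.HodgeConjecture.Cruxes.H413.K2E1BLBorelSpacesU2Defs
open Summit.HodgeConjecture.HodgeConjecture.Cruxes.H413.K2E1BLBorelOperatorsU2Defs
open Summit.HodgeConjecture.HodgeConjecture.Cruxes.H413.K2E1CharacterEisensteinU2Defs
open Summit.HodgeConjecture.HodgeConjecture.Cruxes.H413.K2E1ChiSectionSpaceU2Defs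
open Summit.HodgeConjecture.HodgeConjecture.Cruxes.H413.K2E1ChiScatteringRealPolesM1CMTwoLetterFree (chi_scattering_real_poles_m1_letterFree_cm_two)
open Summit.HodgeConjecture.HodgeConjecture.Cruxes.H413.K2E1ChiScatteringFunctionalEquationM1CMTwo (chi_scattering_fe_m1_cm_two)
open Summit.HodgeConjecture.HodgeConjecture.Cruxes.H413.K2E1ChiMaassSelbergDecayLetterM1CMTwo (hdec_maximalLevel_cm_two)

namespace Summit.HodgeConjecture.HodgeConjecture.Cruxes.H413.K2E1ChiScatteringRealPolesM1CMTwoComplete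

variable (L : Type) [Field L] [NumberField L] [IsCMField L]
variable [MeasurableSpace (quasiSplit (↥(maximalRealSubfield L)) L (IsCMField.complexConj L) 2).Adelic] [BorelSpace (quasiSplit (↥(maximalRealSubfield L)) L (IsCMField.complexConj L) 2).Adelic]
variable [MeasurableSpace (AdeleRing (𝓞 L) L)ˣ] [BorelSpace (AdeleRing (𝓞 L) L)ˣ]

/-- **THE (d)-REALNESS ROAD AT M1 — COMPLETE (no letters beyond the structural data).**  For `χ` self-dual unitary trivial on `ℝ_{>0}` and `φ ∈ V(χ, K_max, 1)` continuous bounded with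
`φ ∘ ι_∞ = φ(1)` and `φ(1) ≠ 0` real: the scalar package of ★ `exists_scattering_scalar_package_selfDual_m1_cm_two` VERBATIM **and** for every `σ₀ > 1`: every non-analytic point of
`s = qc default` with `½ < Re ≤ σ₀` is real with `Re < σ₀` (`hreal`), and there are a finset `S ⊂ (½, σ₀)` of genuine real poles and an open `U′ ⊇ {½ ≤ Re ≤ σ₀}` with `s` holomorphic on
`U′ ∖ S` (`hs`) — ★ p860743 with `hdec` := ★ `hdec_maximalLevel_cm_two` and (FE) := ★ `chi_scattering_fe_m1_cm_two` on the package's own clauses.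
[cite: MoeglinWaldspurger1995, IV.1.10–IV.1.11, IV.3.12 (a)] [cite: BernsteinLapid2019, Thm 2.3, §4–§5] [cite: Langlands1976, §7] -/
theorem chi_scattering_real_poles_m1_complete_cm_two
    (μ : Measure (quasiSplit (↥(maximalRealSubfield L)) L (IsCMField.complexConj L) 2).automorphicQuotient) [(quasiSplit (↥(maximalRealSubfield L)) L (IsCMField.complexConj L) 2).IsAutomorphicMeasure μ]
    (νG : Measure (quasiSplit (↥(maximalRealSubfield L)) L (IsCMField.complexConj L) 2).Adelic) [νG.IsHaarMeasure] [νG.IsInvInvariant] [SFinite νG]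
    (μK : Measure ↥((standardMaximalCompactGL 2 L).comap (adelicVal (↥(maximalRealSubfield L)) L (IsCMField.complexConj L) 2 ((StdForm.antidiagonal 2).over L)) : Subgroup (quasiSplit (↥(maximalRealSubfield L)) L (IsCMField.complexConj L) 2).Adelic)) [μK.IsHaarMeasure]
    (νI : Measure (AdeleRing (𝓞 L) L)ˣ) [νI.IsHaarMeasure]
    {𝓕I : Set (AdeleRing (𝓞 L) L)ˣ} (h𝓕I : IsIdeleClassDomain L 𝓕I)
    (ν : Measure ↥(adelicUnipotent (↥(maximalRealSubfield L)) L (IsCMField.complexConj L) 2)) [ν.IsHaarMeasure] [ν.IsMulRightInvariant] [ν.IsInvInvariant]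
    {𝓕 : Set ↥(adelicUnipotent (↥(maximalRealSubfield L)) L (IsCMField.complexConj L) 2)} (h𝓕N : IsFundamentalDomain ↥(rationalUnipotent (↥(maximalRealSubfield L)) L (IsCMField.complexConj L) 2) 𝓕 ν) (h𝓕1 : ν 𝓕 = 1)
    (h𝓕c : IsCompact (closure 𝓕))
    {β : (quasiSplit (↥(maximalRealSubfield L)) L (IsCMField.complexConj L) 2).Adelic → ℝ≥0∞} (hβ : IsCoveringWeight ↥((arithmeticBorel (↥(maximalRealSubfield L)) L (IsCMField.complexConj L) 2).map (quasiSplit (↥(maximalRealSubfield L)) L (IsCMField.complexConj L) 2).arithmeticSubgroup.subtype) β)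
    {μZ : Measure (borelQuotient (↥(maximalRealSubfield L)) L (IsCMField.complexConj L) 2)} [SFinite μZ]
    (hμZ : ∀ f : borelQuotient (↥(maximalRealSubfield L)) L (IsCMField.complexConj L) 2 → ℝ≥0∞, Measurable f → ∫⁻ z, f z ∂μZ = ∫⁻ g, β g * f (toBorelQuotient (↥(maximalRealSubfield L)) L (IsCMField.complexConj L) 2 g) ∂νG)
    -- the self-dual unitary character and the normalised non-degenerate M1 section
    {χ : HeckeCharacter L} (hχ : χ.IsUnitary) (hρ : ∀ r : ℝ≥0ˣ, χ (posRealIdele L r) = 1) (hsd : reflectChar (IsCMField.complexConj L) χ = χ)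
    {φ : (quasiSplit (↥(maximalRealSubfield L)) L (IsCMField.complexConj L) 2).Adelic → ℂ} (hφV : φ ∈ chiSectionSpace χ ((standardMaximalCompactGL 2 L).comap (adelicVal (↥(maximalRealSubfield L)) L (IsCMField.complexConj L) 2 ((StdForm.antidiagonal 2).over L)) : Subgroup (quasiSplit (↥(maximalRealSubfield L)) L (IsCMField.complexConj L) 2).Adelic) (fun _ => 1)) (hφc : Continuous φ) {Mφ : ℝ} (hφM : ∀ x, ‖φ x‖ ≤ Mφ)
    (hφinf : ∀ a : arch (↥(maximalRealSubfield L)) L (IsCMField.complexConj L) 2 ((StdForm.antidiagonal 2).over L), φ (archToAdelic (↥(maximalRealSubfield L)) L (IsCMField.complexConj L) 2 _ a) = φ 1)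
    (hφ1 : φ 1 ≠ 0) (hφ1r : conj (φ 1) = φ 1) :
    ∃ (bV : Module.Basis Unit ℂ ↥(chiSectionSpace (reflectChar (IsCMField.complexConj L) χ) ((standardMaximalCompactGL 2 L).comap (adelicVal (↥(maximalRealSubfield L)) L (IsCMField.complexConj L) 2 ((StdForm.antidiagonal 2).over L)) : Subgroup (quasiSplit (↥(maximalRealSubfield L)) L (IsCMField.complexConj L) 2).Adelic) (fun _ => 1))) (q : Unit → ℂ → ℂ) (Ec : ℂ → (quasiSplit (↥(maximalRealSubfield L)) L (IsCMField.complexConj L) 2).Adelic → ℂ) (qc : Unit → ℂ → ℂ) (P : Set ℂ),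
      (∀ j, ((bV j : ↥(chiSectionSpace (reflectChar (IsCMField.complexConj L) χ) ((standardMaximalCompactGL 2 L).comap (adelicVal (↥(maximalRealSubfield L)) L (IsCMField.complexConj L) 2 ((StdForm.antidiagonal 2).over L)) : Subgroup (quasiSplit (↥(maximalRealSubfield L)) L (IsCMField.complexConj L) 2).Adelic) (fun _ => 1))) : (quasiSplit (↥(maximalRealSubfield L)) L (IsCMField.complexConj L) 2).Adelic → ℂ) = φ) ∧
      ((∀ j, DifferentiableOn ℂ (q j) {z : ℂ | 1 < z.re}) ∧
      (∀ z : ℂ, 1 < z.re → (∑ j, q j z • ((bV j : ↥(chiSectionSpace (reflectChar (IsCMField.complexConj L) χ) ((standardMaximalCompactGL 2 L).comap (adelicVal (↥(maximalRealSubfield L)) L (IsCMField.complexConj L) 2 ((StdForm.antidiagonal 2).over L)) : Subgroup (quasiSplit (↥(maximalRealSubfield L)) L (IsCMField.complexConj L) 2).Adelic) (fun _ => 1))) : (quasiSplit (↥(maximalRealSubfield L)) L (IsCMField.complexConj L) 2).Adelic → ℂ)) = ((((ν 𝓕).toReal⁻¹ : ℝ)) : ℂ) • (fun g : (quasiSplit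 (↥(maximalRealSubfield L)) L (IsCMField.complexConj L) 2).Adelic => (∫ v : ↥(adelicUnipotent (↥(maximalRealSubfield L)) L (IsCMField.complexConj L) 2), flatSectionU φ z ((quasiSplit (↥(maximalRealSubfield L)) L (IsCMField.complexConj L) 2).toAdelic (weylLongU ((IsCMField.complexConj L : L ≃ₐ[↥(maximalRealSubfield L)] L) : L →+* L) (rfl : (StdForm.antidiagonal 2).over L = (StdForm.antidiagonal 2).over L)) * ((v : (quasiSplit (↥(maximalRealSubfield L)) L (IsCMField.complexConj L) 2).Adelic) * g)) ∂ν) * (((borelHeight g : ℝ) : ℂ) ^ (z - 1)))) ∧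
      (∀ g, MeromorphicNFOn (fun z => Ec z g) univ) ∧ (∀ j, MeromorphicNFOn (qc j) univ) ∧
      (∀ z : ℂ, 1 < z.re → Ec z = eisensteinSeriesU (flatSectionU φ z)) ∧ (∀ j (z : ℂ), 1 < z.re → qc j z = q j z) ∧
      IsClosed P ∧ (∀ z₀ : ℂ, ∀ᶠ s in 𝓝[≠] z₀, s ∉ P) ∧ (∀ z ∈ P, z.re ≤ 1) ∧
      (∀ g (z : ℂ), z ∉ P → AnalyticAt ℂ (fun z => Ec z g) z) ∧ (∀ j (z : ℂ), z ∉ P → AnalyticAt ℂ (qc j) z) ∧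
      (∀ g, DifferentiableOn ℂ (fun z => Ec z g) Pᶜ) ∧ (∀ j, DifferentiableOn ℂ (qc j) Pᶜ) ∧
      (∀ z : ℂ, z ∉ P → Continuous (Ec z)) ∧
      ∀ n : ℕ, ∃ U : Set ℂ, IsOpen U ∧ U ⊆ Metric.ball (0 : ℂ) (n + 2) ∧ (∀ z₀ ∈ Metric.ball (0 : ℂ) (n + 2), ∀ᶠ s in 𝓝[≠] z₀, s ∈ U) ∧
        ∃ T₀ : ℝ≥0, 1 ≤ T₀ ∧ ∃ Fam : ℂ → Lp ℂ 2 μ, DifferentiableOn ℂ Fam (U \ P) ∧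
          ∀ z ∈ U \ P, ((Fam z : Lp ℂ 2 μ) : (quasiSplit (↥(maximalRealSubfield L)) L (IsCMField.complexConj L) 2).automorphicQuotient → ℂ) =ᵐ[μ]
            (quasiSplit (↥(maximalRealSubfield L)) L (IsCMField.complexConj L) 2).quotFun (truncation ν 𝓕 T₀ (Ec z))) ∧
      (∀ z : ℂ, 1 < z.re → qc default z = (((ν 𝓕).toReal⁻¹ : ℝ) : ℂ) * ((φ 1)⁻¹ * ∫ v : ↥(adelicUnipotent (↥(maximalRealSubfield L)) L (IsCMField.complexConj L) 2), flatSectionU φ z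
        ((quasiSplit (↥(maximalRealSubfield L)) L (IsCMField.complexConj L) 2).toAdelic (weylLongU (IsCMField.complexConj L : L →+* L)
          (rfl : (StdForm.antidiagonal 2).over L = (StdForm.antidiagonal 2).over L)) * ((v : (quasiSplit (↥(maximalRealSubfield L)) L (IsCMField.complexConj L) 2).Adelic) * 1)) ∂ν)) ∧
      ∀ σ₀ : ℝ, 1 < σ₀ →
        (∀ z : ℂ, ¬ AnalyticAt ℂ (qc default) z → 1 / 2 < z.re → z.re ≤ σ₀ → z.im = 0 ∧ z.re < σ₀) ∧
          ∃ (S : Finset ℝ) (U' : Set ℂ), (∀ x ∈ S, ¬ AnalyticAt ℂ (qc default) (x : ℂ) ∧ 1 / 2 < x ∧ x < σ₀) ∧ IsOpen U' ∧ {z : ℂ | 1 / 2 ≤ z.re ∧ z.re ≤ σ₀} ⊆ U' ∧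
            DifferentiableOn ℂ (qc default) (U' \ ((S.image fun x : ℝ => (x : ℂ)) : Set ℂ)) := by
  classical
  have hφ0 : φ ≠ 0 := fun h => hφ1 (by rw [h, Pi.zero_apply])
  obtain ⟨bV, q, Ec, qc, P, hbV, ⟨hq, hqφ, hEcNF, hqNF, hE1, hqcq, hPc, hPcd, hPre, hEan, hqa, hEdiff, hqdiff, hEcont, hF⟩, htube, hbill⟩ :=
    chi_scattering_real_poles_m1_letterFree_cm_two L μ νG μK νI h𝓕I ν h𝓕N h𝓕1 h𝓕c hβ hχ hρ hsd hφV hφc hφM hφ1 hφ1r hφinf hμZ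
      (hdec_maximalLevel_cm_two L ν h𝓕N h𝓕c hχ hφV hφc hφM hφinf)
  refine ⟨bV, q, Ec, qc, P, hbV, ⟨hq, hqφ, hEcNF, hqNF, hE1, hqcq, hPc, hPcd, hPre, hEan, hqa, hEdiff, hqdiff, hEcont, hF⟩, htube, fun σ₀ hσ₀ => hbill σ₀ hσ₀ ?_⟩
  -- σ2: the scalar functional equation on THIS package (★ `chi_scattering_fe_m1_cm_two`)
  have hqφ' : ∀ z : ℂ, 1 < z.re → (∑ j, q j z • φ) = ((((ν 𝓕).toReal⁻¹ : ℝ)) : ℂ) • (fun g : (quasiSplit (↥(maximalRealSubfield L)) L (IsCMField.complexConj L) 2).Adelic => (∫ v : ↥(adelicUnipotent (↥(maximalRealSubfield L)) L (IsCMField.complexConj L) 2), flatSectionU φ z ((quasiSplit (↥(maximalRealSubfield L)) L (IsCMField.complexConj L) 2).toAdelic (weylLongU ((IsCMField.complexConj L : L ≃ₐ[↥(maximalRealSubfield L)] L) : L →+* L) (rfl : (StdForm.antidiagonal 2).over L = (StdForm.antidiagonal 2).over L)) * ((v : (quasiSplit (↥(maximalRealSubfield L)) L (IsCMField.complexConj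 L) 2).Adelic) * g)) ∂ν) * (((borelHeight g : ℝ) : ℂ) ^ (z - 1))) := fun z hz => by
    rw [← hqφ z hz]
    exact Finset.sum_congr rfl fun j _ => by rw [hbV j]
  exact chi_scattering_fe_m1_cm_two L μ νG ν h𝓕N h𝓕c (by rw [h𝓕1]; exact one_ne_zero) hβ hμZ hsd hφV hφc hφM hφinf hφ0 hqφ' hqcq hPc hPcd hPre hqa

end Summit.HodgeConjecture.HodgeConjecture.Cruxes.H413.K2E1ChiScatteringRealPolesM1CMTwoComplete

end
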